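import Literature.NumberTheory.EllipticCurves.PAdicLFunctionTameBirchMinusMeasureProofs
import Literature.NumberTheory.EllipticCurves.PAdicLFunctionTameMinusBirchTransformProofs
import Literature.NumberTheory.EllipticCurves.PAdicLFunctionTameBranch
import Literature.NumberTheory.EllipticCurves.PAdicMeasureTransformBranchTranslationProofs
import HarnessLib

/-!
# Birch's lemma for the `ω^i`-BRANCHES of the MINUS measure of a twist:
# `ω(m)^i · L⁻_p(g, χ(p)α, ω^i, T) = C(c)·(1+T)^{−f_m}·L^∓_p(f, m, α, ω^i χ, T)` from `[x]⁻_g = c · Σ_b χ(b) [x + b/m]^∓_f` (PROOFS ONLY)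

`Proofs` companion (theorems only; no definition, no named fact) of `PAdicLFunctionTameBranch` (the `ω^i`-branches
`padicLFunctionTameBranch` / `padicLFunctionTameMinusBranch` of the tame transforms) and the branch twin of
`PAdicLFunctionTameMinusBirchTransformProofs` / `PAdicLFunctionTameBirchTransformProofs` (Mazur–Tate–Teitelbaum §I.8–§I.13; Matsuno 2000
§2 p. 84): the measure-level Birch lemmas for the MINUS measure of the twist `g = f ⊗ χ`
(`msdMinusMeasure_twist_eq_sum_msdMeasureTameMinus` for even `χ`, `msdMinusMeasure_twist_eq_sum_msdMeasureTame` for odd `χ`) are fed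
into the `ω^i`-weighted translation lemma `tendsto_weightedRiemannSum_translate`; the translation by `m = ω(m)·γ^{f_m}` now costs the
root of unity `ω(m)^i` besides the factor `(1+T)^{−f_m}`:

* `padicLMinusBranchRiemannSum_twist_eq_minus` / `…_eq_plus` — the branch Riemann sums of `μ⁻_{g, χ(p)α}` are `c` times the TRANSLATED
  weighted sums of the `χ`-weighted minus (even `χ`) / plus (odd `χ`) tame measure of `f`;
* `padicLMinusBranchCoeff_twist_eq_minus` / `…_eq_plus` —
  `ω(m)^i · [T^k] L⁻_p(g, χ(p)α, ω^i) = c · Σ_{j≤k} (−f_m choose k−j) · [T^j] L^∓_p(f, m, α, ω^i χ)`;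
* **`padicLFunctionMinusBranch_twist_eq_of_birch_even`** / **`…_of_birch_odd`** —
  `C(ω(m)^i) · L⁻_p(g, χ(p)α, ω^i, T) = C(c) · (1+T)^{−f_m} · L⁻_p(f, m, α, ω^i χ, T)` (even `χ`), resp. `… · L_p(f, m, α, ω^i χ, T)` (odd `χ`),
  in `ℚ_p⟦T⟧`, under `hB : ∀ x, [x]⁻_g = c · Σ_{b mod m} χ(b) [x + b/m]^∓_f` (the shapes of `exists_rat_forall_ratMinusSymbol_charTwist_eq[_of_odd]`)
  and `hc : ω(m)·γ^{f_m} ≡ m` (`teich = ω(m)`, supplied by `exists_teichmuller_frobeniusExponent`).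

At `p = 2`, `i = 1` (`ω = χ₄`, `ω(m) = χ₄(m) = ±1`) these are the transport identities G4 of the odd-class Birch transport of crux
stmt-BirchSwinnertonDyer-20368 road (C) (memo `Cruxes/SplitBadTwoRankOneOfFacts/PERIOD-CANCELS-w8g24.md` §8).

References: B. Mazur, J. Tate, J. Teitelbaum, Invent. Math. 84 (1986), §I.8–§I.13 [MazurTateTeitelbaum1986Invent]; K. Matsuno,
J. Number Theory 84 (2000), §2 (p. 84), Lemma 3.3 [Matsuno2000].
-/

noncomputable section

open scoped MatrixGroups ModularForm

open CongruenceSubgroup Filter Topology PowerSeries Literature.NumberTheory.EllipticCurves.ModularForms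
  Literature.NumberTheory.EllipticCurves.GreenbergVatsal2000

namespace Literature.NumberTheory.EllipticCurves

section BranchBirchTransform

variable {N N' : ℕ} [NeZero N] [NeZero N'] (f : CuspForm (Gamma0 N) 2) (g : CuspForm (Gamma0 N') 2)
  {p : ℕ} [Fact p.Prime] {m : ℕ} [NeZero m]

/-- A root of unity of `ℤ_p`, raised to any power, is non-zero in `ℚ_p`. [cite: MazurTateTeitelbaum1986Invent, §I.13] -/
theorem coe_rootsOfUnity_pow_ne_zero (teich : rootsOfUnity (torsionOrder p) ℤ_[p]) (i : ℕ) :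
    (((teich : ℤ_[p]ˣ) : ℤ_[p]) : ℚ_[p]) ^ i ≠ 0 :=
  pow_ne_zero i (PadicInt.coe_ne_zero.mpr (teich : ℤ_[p]ˣ).ne_zero)

/-! ### Even `χ`: the minus measure of the twist on the MINUS tame measure of `f` -/

omit [NeZero N'] in
/-- **The branch Riemann sums of the minus measure of the twist are `c` times the TRANSLATED weighted minus tame sums** (even `χ`):
under `hB : [x]⁻_g = c·Σ_b χ(b)[x + b/m]⁻_f`, for `m ≡ ω(m) γ^{e}` (`teich`, `hc`),
`Σ_ζ ζ^i Σ_s μ⁻_{g,χ(p)α}(ζγˢ) C(s,k) = c · Σ_ζ ζ^i Σ_s ν_χ((ω(m)γ^{e})·(ζγˢ)) C(s,k)`, `ν_χ(x) = Σ_b χ(b) μ⁻_{f,α,m}(x × {b})`.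
[cite: MazurTateTeitelbaum1986Invent, §I.8–I.13 (pp. 10–19)] -/
theorem padicLMinusBranchRiemannSum_twist_eq_minus (hmp : m.Coprime p) (χ : MulChar (ZMod m) ℚ) (hχp : χ (p : ZMod m) ^ 2 = 1)
    {c : ℚ} (hB : ∀ x : ℚ, ratMinusSymbol g x = c * ∑ b : ZMod m, χ b * ratMinusSymbol f (x + (b.val : ℚ) / m))
    (α : ℚ_[p]) {teich : rootsOfUnity (torsionOrder p) ℤ_[p]} {e : ℤ_[p]}
    (hc : ∀ n : ℕ, PadicInt.toZModPow (n + cyclotomicExponent p) ((teich : ℤ_[p]ˣ) : ℤ_[p]) *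
        (cyclotomicGenerator p : ZMod (p ^ (n + cyclotomicExponent p))) ^ (PadicInt.toZModPow n e).val =
          (m : ZMod (p ^ (n + cyclotomicExponent p)))) (i k n : ℕ) :
    padicLMinusBranchRiemannSum g (((χ (p : ZMod m) : ℚ) : ℚ_[p]) * α) i k n =
      (c : ℚ_[p]) * ∑ᶠ zz : rootsOfUnity (torsionOrder p) ℤ_[p], ∑ s : ZMod (p ^ n),
        (((zz : ℤ_[p]ˣ) : ℤ_[p]) : ℚ_[p]) ^ i *
          (fun (n : ℕ) (a : ZMod (p ^ n)) ↦
              ∑ b : ZMod m, (χ.ringHomComp (Rat.castHom ℚ_[p])) b * msdMeasureTameMinus f m α n a b)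
            (n + cyclotomicExponent p)
            ((PadicInt.toZModPow (n + cyclotomicExponent p) ((teich : ℤ_[p]ˣ) : ℤ_[p]) *
                (cyclotomicGenerator p : ZMod (p ^ (n + cyclotomicExponent p))) ^ (PadicInt.toZModPow n e).val) *
              (PadicInt.toZModPow (n + cyclotomicExponent p) ((zz : ℤ_[p]ˣ) : ℤ_[p]) *
                (cyclotomicGenerator p : ZMod (p ^ (n + cyclotomicExponent p))) ^ s.val)) *
          ((s.val.choose k : ℕ) : ℚ_[p]) := by
  classical
  haveI := neZero_torsionOrder p
  haveI := Fintype.ofFinite (rootsOfUnity (torsionOrder p) ℤ_[p])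
  unfold padicLMinusBranchRiemannSum
  rw [finsum_eq_sum_of_fintype, finsum_eq_sum_of_fintype, Finset.mul_sum]
  refine Finset.sum_congr rfl fun zz _ ↦ ?_
  rw [Finset.mul_sum]
  refine Finset.sum_congr rfl fun s _ ↦ ?_
  rw [msdMinusMeasure_twist_eq_sum_msdMeasureTameMinus f g hmp χ hχp hB α, hc n,
    mul_comm (m : ZMod (p ^ (n + cyclotomicExponent p)))]
  simp only [MulChar.ringHomComp_apply, eq_ratCast]
  ring

omit [NeZero N'] in
/-- **Birch's lemma for the branch coefficients, even `χ`**: under `hB` and the convergence hypotheses for `f` (rational normalised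
newform of level prime to `p`, `(m,p) = 1`, `α` the unit root), with `teich = ω(m)` (`hc`, from `exists_teichmuller_frobeniusExponent`):
`ω(m)^i · [T^k] L⁻_p(g, χ(p)α, ω^i) = c · Σ_{j≤k} (−f_m choose k−j) · [T^j] L⁻_p(f, m, α, ω^i χ)`, `f_m = frobeniusExponent p m`
(`tendsto_weightedRiemannSum_translate` for the `χ`-weighted minus tame measure translated by `m`).
[cite: MazurTateTeitelbaum1986Invent, §I.8–I.13 (pp. 10–19)] [cite: Matsuno2000, §2 (p. 84), Lemma 3.3] -/
theorem padicLMinusBranchCoeff_twist_eq_minus (hf : IsNewform0 f) (hQ : coeffField f = ⊥) (hpN : ¬ p ∣ N) (hmp : m.Coprime p)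
    {ap : ℤ} (hap : cuspCoeff f p = ap) {α : ℚ_[p]} (hα : α ^ 2 - ap * α + p = 0) (hαu : ‖α‖ = 1)
    (χ : MulChar (ZMod m) ℚ) (hχp : χ (p : ZMod m) ^ 2 = 1) {c : ℚ}
    (hB : ∀ x : ℚ, ratMinusSymbol g x = c * ∑ b : ZMod m, χ b * ratMinusSymbol f (x + (b.val : ℚ) / m))
    {teich : rootsOfUnity (torsionOrder p) ℤ_[p]}
    (hc : ∀ n : ℕ, PadicInt.toZModPow (n + cyclotomicExponent p) ((teich : ℤ_[p]ˣ) : ℤ_[p]) *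
        (cyclotomicGenerator p : ZMod (p ^ (n + cyclotomicExponent p))) ^
          (PadicInt.toZModPow n (frobeniusExponent p (m : ℤ_[p]))).val =
          (m : ZMod (p ^ (n + cyclotomicExponent p)))) (i k : ℕ) :
    (((teich : ℤ_[p]ˣ) : ℤ_[p]) : ℚ_[p]) ^ i * padicLMinusBranchCoeff g (((χ (p : ZMod m) : ℚ) : ℚ_[p]) * α) i k =
      (c : ℚ_[p]) * ∑ j ∈ Finset.range (k + 1),
        algebraMap ℤ_[p] ℚ_[p] (Ring.choose (-frobeniusExponent p (m : ℤ_[p])) (k - j)) *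
          padicLCoeffTameMinusBranch f m α (χ.ringHomComp (Rat.castHom ℚ_[p])) i j := by
  classical
  set χp : DirichletCharacter ℚ_[p] m := χ.ringHomComp (Rat.castHom ℚ_[p]) with hχp_def
  have hα0 : α ≠ 0 := norm_ne_zero_iff.mp (by rw [hαu]; exact one_ne_zero)
  have hdist := sum_filter_weighted_msdMeasureTameMinus_succ f hf (ratCast_ratMinusSymbol f hf hQ) hpN hmp
    hap hα0 hα χp
  obtain ⟨C, hC⟩ := exists_norm_weighted_msdMeasureTameMinus_le f
    (exists_nsmul_modularSymbol_mem_periodLattice_of_isNewform0 hf hQ) hαu χp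
  have hRSdef : ∀ k n : ℕ, padicLRiemannSumTameMinusBranch f m α χp i k n =
      ∑ᶠ zz : rootsOfUnity (torsionOrder p) ℤ_[p], ∑ s : ZMod (p ^ n),
        (((zz : ℤ_[p]ˣ) : ℤ_[p]) : ℚ_[p]) ^ i *
          (fun (n : ℕ) (a : ZMod (p ^ n)) ↦ ∑ b : ZMod m, χp b * msdMeasureTameMinus f m α n a b)
            (n + cyclotomicExponent p)
            (PadicInt.toZModPow (n + cyclotomicExponent p) ((zz : ℤ_[p]ˣ) : ℤ_[p]) *
              (cyclotomicGenerator p : ZMod (p ^ (n + cyclotomicExponent p))) ^ s.val) *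
          ((s.val.choose k : ℕ) : ℚ_[p]) := by
    intro k n
    simp only [padicLRiemannSumTameMinusBranch, Finset.mul_sum, Finset.sum_mul, mul_assoc]
  set RSz : ℕ → ℕ → ℚ_[p] := fun k n ↦ ∑ᶠ zz : rootsOfUnity (torsionOrder p) ℤ_[p], ∑ s : ZMod (p ^ n),
        (((zz : ℤ_[p]ˣ) : ℤ_[p]) : ℚ_[p]) ^ i *
          (fun (n : ℕ) (a : ZMod (p ^ n)) ↦ ∑ b : ZMod m, χp b * msdMeasureTameMinus f m α n a b)
            (n + cyclotomicExponent p)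
            ((PadicInt.toZModPow (n + cyclotomicExponent p) ((teich : ℤ_[p]ˣ) : ℤ_[p]) *
                (cyclotomicGenerator p : ZMod (p ^ (n + cyclotomicExponent p))) ^
                  (PadicInt.toZModPow n (frobeniusExponent p (m : ℤ_[p]))).val) *
              (PadicInt.toZModPow (n + cyclotomicExponent p) ((zz : ℤ_[p]ˣ) : ℤ_[p]) *
                (cyclotomicGenerator p : ZMod (p ^ (n + cyclotomicExponent p))) ^ s.val)) *
          ((s.val.choose k : ℕ) : ℚ_[p]) with hRSz_def
  have hRSz : ∀ k n : ℕ, RSz k n = ∑ᶠ zz : rootsOfUnity (torsionOrder p) ℤ_[p], ∑ s : ZMod (p ^ n),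
        (((zz : ℤ_[p]ˣ) : ℤ_[p]) : ℚ_[p]) ^ i *
          (fun (n : ℕ) (a : ZMod (p ^ n)) ↦ ∑ b : ZMod m, χp b * msdMeasureTameMinus f m α n a b)
            (n + cyclotomicExponent p)
            ((PadicInt.toZModPow (n + cyclotomicExponent p) ((teich : ℤ_[p]ˣ) : ℤ_[p]) *
                (cyclotomicGenerator p : ZMod (p ^ (n + cyclotomicExponent p))) ^
                  (PadicInt.toZModPow n (frobeniusExponent p (m : ℤ_[p]))).val) *
              (PadicInt.toZModPow (n + cyclotomicExponent p) ((zz : ℤ_[p]ˣ) : ℤ_[p]) *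
                (cyclotomicGenerator p : ZMod (p ^ (n + cyclotomicExponent p))) ^ s.val)) *
          ((s.val.choose k : ℕ) : ℚ_[p]) := fun k n ↦ by rw [hRSz_def]
  have hlim := tendsto_weightedRiemannSum_translate hdist hC hRSdef hRSz k
  have hRS : ∀ n, padicLMinusBranchRiemannSum g (((χ (p : ZMod m) : ℚ) : ℚ_[p]) * α) i k n = (c : ℚ_[p]) * RSz k n :=
    fun n ↦ by
    rw [hRSz_def]
    exact padicLMinusBranchRiemannSum_twist_eq_minus f g hmp χ hχp hB α hc i k n
  have hti := coe_rootsOfUnity_pow_ne_zero teich i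
  have hT : Tendsto (padicLMinusBranchRiemannSum g (((χ (p : ZMod m) : ℚ) : ℚ_[p]) * α) i k) atTop
      (𝓝 (((((teich : ℤ_[p]ˣ) : ℤ_[p]) : ℚ_[p]) ^ i)⁻¹ * ((c : ℚ_[p]) * ∑ j ∈ Finset.range (k + 1),
        algebraMap ℤ_[p] ℚ_[p] (Ring.choose (-frobeniusExponent p (m : ℤ_[p])) (k - j)) *
          limUnder atTop (fun n ↦ padicLRiemannSumTameMinusBranch f m α χp i j n)))) := by
    refine (((hlim.const_mul (c : ℚ_[p])).const_mul ((((teich : ℤ_[p]ˣ) : ℤ_[p]) : ℚ_[p]) ^ i)⁻¹).congr fun n ↦ ?_)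
    rw [hRS n, ← mul_assoc, ← mul_assoc, mul_right_comm _ (c : ℚ_[p]), inv_mul_cancel₀ hti, one_mul]
  rw [padicLMinusBranchCoeff, hT.limUnder_eq, ← mul_assoc, mul_inv_cancel₀ hti, one_mul]
  rfl

omit [NeZero N'] in
/-- **Birch's lemma for the branch transforms, even `χ`.** Under `hB : ∀ x, [x]⁻_g = c · Σ_{b mod m} χ(b) [x + b/m]⁻_f` (`χ` a `ℚ`-valued
character mod `m`, `(m,p) = 1`, `χ(p)² = 1`), `hc : ω(m)·γ^{f_m} ≡ m` and the standing hypotheses on `f`: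
`C(ω(m)^i) · L⁻_p(g, χ(p)α, ω^i, T) = C(c) · (1+T)^{−f_m} · L⁻_p(f, m, α, ω^i χ, T)` in `ℚ_p⟦T⟧`.
[cite: MazurTateTeitelbaum1986Invent, §I.8–I.13 (pp. 10–19)] [cite: Matsuno2000, §2 (p. 84)] -/
theorem padicLFunctionMinusBranch_twist_eq_of_birch_even (hf : IsNewform0 f) (hQ : coeffField f = ⊥) (hpN : ¬ p ∣ N)
    (hmp : m.Coprime p) {ap : ℤ} (hap : cuspCoeff f p = ap) {α : ℚ_[p]} (hα : α ^ 2 - ap * α + p = 0) (hαu : ‖α‖ = 1)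
    (χ : MulChar (ZMod m) ℚ) (hχp : χ (p : ZMod m) ^ 2 = 1) {c : ℚ}
    (hB : ∀ x : ℚ, ratMinusSymbol g x = c * ∑ b : ZMod m, χ b * ratMinusSymbol f (x + (b.val : ℚ) / m))
    {teich : rootsOfUnity (torsionOrder p) ℤ_[p]}
    (hc : ∀ n : ℕ, PadicInt.toZModPow (n + cyclotomicExponent p) ((teich : ℤ_[p]ˣ) : ℤ_[p]) *
        (cyclotomicGenerator p : ZMod (p ^ (n + cyclotomicExponent p))) ^
          (PadicInt.toZModPow n (frobeniusExponent p (m : ℤ_[p]))).val =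
          (m : ZMod (p ^ (n + cyclotomicExponent p)))) (i : ℕ) :
    C ((((teich : ℤ_[p]ˣ) : ℤ_[p]) : ℚ_[p]) ^ i) * padicLFunctionMinusBranch g (((χ (p : ZMod m) : ℚ) : ℚ_[p]) * α) i =
      C (c : ℚ_[p]) * PowerSeries.binomialSeries ℚ_[p] (-frobeniusExponent p (m : ℤ_[p])) *
        padicLFunctionTameMinusBranch f m α (χ.ringHomComp (Rat.castHom ℚ_[p])) i := by
  ext k
  rw [PowerSeries.coeff_C_mul, coeff_padicLFunctionMinusBranch,
    padicLMinusBranchCoeff_twist_eq_minus f g hf hQ hpN hmp hap hα hαu χ hχp hB hc i k, coeff_C_mul_binomialSeries_mul]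
  congr 1
  refine Finset.sum_congr rfl fun j _ ↦ ?_
  rw [coeff_padicLFunctionTameMinusBranch]

/-! ### Odd `χ`: the minus measure of the twist on the PLUS tame measure of `f` -/

omit [NeZero N'] in
/-- **The branch Riemann sums of the minus measure of the twist are `c` times the TRANSLATED weighted plus tame sums** (odd `χ`):
under `hB : [x]⁻_g = c·Σ_b χ(b)[x + b/m]⁺_f`, for `m ≡ ω(m) γ^{e}`,
`Σ_ζ ζ^i Σ_s μ⁻_{g,χ(p)α}(ζγˢ) C(s,k) = c · Σ_ζ ζ^i Σ_s ν_χ((ω(m)γ^{e})·(ζγˢ)) C(s,k)`, `ν_χ(x) = Σ_b χ(b) μ_{f,α,m}(x × {b})`.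
[cite: MazurTateTeitelbaum1986Invent, §I.8–I.13 (pp. 10–19)] -/
theorem padicLMinusBranchRiemannSum_twist_eq_plus (hmp : m.Coprime p) (χ : MulChar (ZMod m) ℚ) (hχp : χ (p : ZMod m) ^ 2 = 1)
    {c : ℚ} (hB : ∀ x : ℚ, ratMinusSymbol g x = c * ∑ b : ZMod m, χ b * ratPlusSymbol f (x + (b.val : ℚ) / m))
    (α : ℚ_[p]) {teich : rootsOfUnity (torsionOrder p) ℤ_[p]} {e : ℤ_[p]}
    (hc : ∀ n : ℕ, PadicInt.toZModPow (n + cyclotomicExponent p) ((teich : ℤ_[p]ˣ) : ℤ_[p]) *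
        (cyclotomicGenerator p : ZMod (p ^ (n + cyclotomicExponent p))) ^ (PadicInt.toZModPow n e).val =
          (m : ZMod (p ^ (n + cyclotomicExponent p)))) (i k n : ℕ) :
    padicLMinusBranchRiemannSum g (((χ (p : ZMod m) : ℚ) : ℚ_[p]) * α) i k n =
      (c : ℚ_[p]) * ∑ᶠ zz : rootsOfUnity (torsionOrder p) ℤ_[p], ∑ s : ZMod (p ^ n),
        (((zz : ℤ_[p]ˣ) : ℤ_[p]) : ℚ_[p]) ^ i *
          (fun (n : ℕ) (a : ZMod (p ^ n)) ↦
              ∑ b : ZMod m, (χ.ringHomComp (Rat.castHom ℚ_[p])) b * msdMeasureTame f m α n a b)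
            (n + cyclotomicExponent p)
            ((PadicInt.toZModPow (n + cyclotomicExponent p) ((teich : ℤ_[p]ˣ) : ℤ_[p]) *
                (cyclotomicGenerator p : ZMod (p ^ (n + cyclotomicExponent p))) ^ (PadicInt.toZModPow n e).val) *
              (PadicInt.toZModPow (n + cyclotomicExponent p) ((zz : ℤ_[p]ˣ) : ℤ_[p]) *
                (cyclotomicGenerator p : ZMod (p ^ (n + cyclotomicExponent p))) ^ s.val)) *
          ((s.val.choose k : ℕ) : ℚ_[p]) := by
  classical
  haveI := neZero_torsionOrder p
  haveI := Fintype.ofFinite (rootsOfUnity (torsionOrder p) ℤ_[p])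
  unfold padicLMinusBranchRiemannSum
  rw [finsum_eq_sum_of_fintype, finsum_eq_sum_of_fintype, Finset.mul_sum]
  refine Finset.sum_congr rfl fun zz _ ↦ ?_
  rw [Finset.mul_sum]
  refine Finset.sum_congr rfl fun s _ ↦ ?_
  rw [msdMinusMeasure_twist_eq_sum_msdMeasureTame f g hmp χ hχp hB α, hc n,
    mul_comm (m : ZMod (p ^ (n + cyclotomicExponent p)))]
  simp only [MulChar.ringHomComp_apply, eq_ratCast]
  ring

omit [NeZero N'] in
/-- **Birch's lemma for the branch coefficients, odd `χ`**: under `hB : [x]⁻_g = c·Σ_b χ(b)[x + b/m]⁺_f`, `hc : ω(m)·γ^{f_m} ≡ m`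
and the convergence hypotheses for `f`:
`ω(m)^i · [T^k] L⁻_p(g, χ(p)α, ω^i) = c · Σ_{j≤k} (−f_m choose k−j) · [T^j] L_p(f, m, α, ω^i χ)` (PLUS tame branch).
[cite: MazurTateTeitelbaum1986Invent, §I.8–I.13 (pp. 10–19)] [cite: Matsuno2000, §2 (p. 84), Lemma 3.3] -/
theorem padicLMinusBranchCoeff_twist_eq_plus (hf : IsNewform0 f) (hQ : coeffField f = ⊥) (hpN : ¬ p ∣ N) (hmp : m.Coprime p)
    {ap : ℤ} (hap : cuspCoeff f p = ap) {α : ℚ_[p]} (hα : α ^ 2 - ap * α + p = 0) (hαu : ‖α‖ = 1)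
    (χ : MulChar (ZMod m) ℚ) (hχp : χ (p : ZMod m) ^ 2 = 1) {c : ℚ}
    (hB : ∀ x : ℚ, ratMinusSymbol g x = c * ∑ b : ZMod m, χ b * ratPlusSymbol f (x + (b.val : ℚ) / m))
    {teich : rootsOfUnity (torsionOrder p) ℤ_[p]}
    (hc : ∀ n : ℕ, PadicInt.toZModPow (n + cyclotomicExponent p) ((teich : ℤ_[p]ˣ) : ℤ_[p]) *
        (cyclotomicGenerator p : ZMod (p ^ (n + cyclotomicExponent p))) ^
          (PadicInt.toZModPow n (frobeniusExponent p (m : ℤ_[p]))).val =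
          (m : ZMod (p ^ (n + cyclotomicExponent p)))) (i k : ℕ) :
    (((teich : ℤ_[p]ˣ) : ℤ_[p]) : ℚ_[p]) ^ i * padicLMinusBranchCoeff g (((χ (p : ZMod m) : ℚ) : ℚ_[p]) * α) i k =
      (c : ℚ_[p]) * ∑ j ∈ Finset.range (k + 1),
        algebraMap ℤ_[p] ℚ_[p] (Ring.choose (-frobeniusExponent p (m : ℤ_[p])) (k - j)) *
          padicLCoeffTameBranch f m α (χ.ringHomComp (Rat.castHom ℚ_[p])) i j := by
  classical
  set χp : DirichletCharacter ℚ_[p] m := χ.ringHomComp (Rat.castHom ℚ_[p]) with hχp_def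
  have hα0 : α ≠ 0 := norm_ne_zero_iff.mp (by rw [hαu]; exact one_ne_zero)
  have hdist := sum_filter_weighted_msdMeasureTame_succ f hf (fun r ↦ ratCast_ratPlusSymbol_holds hf hQ r) hpN hmp
    hap hα0 hα χp
  obtain ⟨C, hC⟩ := exists_norm_weighted_msdMeasureTame_le f
    (exists_nsmul_modularSymbol_mem_periodLattice_of_isNewform0 hf hQ) hαu χp
  have hRSdef : ∀ k n : ℕ, padicLRiemannSumTameBranch f m α χp i k n =
      ∑ᶠ zz : rootsOfUnity (torsionOrder p) ℤ_[p], ∑ s : ZMod (p ^ n),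
        (((zz : ℤ_[p]ˣ) : ℤ_[p]) : ℚ_[p]) ^ i *
          (fun (n : ℕ) (a : ZMod (p ^ n)) ↦ ∑ b : ZMod m, χp b * msdMeasureTame f m α n a b)
            (n + cyclotomicExponent p)
            (PadicInt.toZModPow (n + cyclotomicExponent p) ((zz : ℤ_[p]ˣ) : ℤ_[p]) *
              (cyclotomicGenerator p : ZMod (p ^ (n + cyclotomicExponent p))) ^ s.val) *
          ((s.val.choose k : ℕ) : ℚ_[p]) := by
    intro k n
    simp only [padicLRiemannSumTameBranch, Finset.mul_sum, Finset.sum_mul, mul_assoc]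
  set RSz : ℕ → ℕ → ℚ_[p] := fun k n ↦ ∑ᶠ zz : rootsOfUnity (torsionOrder p) ℤ_[p], ∑ s : ZMod (p ^ n),
        (((zz : ℤ_[p]ˣ) : ℤ_[p]) : ℚ_[p]) ^ i *
          (fun (n : ℕ) (a : ZMod (p ^ n)) ↦ ∑ b : ZMod m, χp b * msdMeasureTame f m α n a b)
            (n + cyclotomicExponent p)
            ((PadicInt.toZModPow (n + cyclotomicExponent p) ((teich : ℤ_[p]ˣ) : ℤ_[p]) *
                (cyclotomicGenerator p : ZMod (p ^ (n + cyclotomicExponent p))) ^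
                  (PadicInt.toZModPow n (frobeniusExponent p (m : ℤ_[p]))).val) *
              (PadicInt.toZModPow (n + cyclotomicExponent p) ((zz : ℤ_[p]ˣ) : ℤ_[p]) *
                (cyclotomicGenerator p : ZMod (p ^ (n + cyclotomicExponent p))) ^ s.val)) *
          ((s.val.choose k : ℕ) : ℚ_[p]) with hRSz_def
  have hRSz : ∀ k n : ℕ, RSz k n = ∑ᶠ zz : rootsOfUnity (torsionOrder p) ℤ_[p], ∑ s : ZMod (p ^ n),
        (((zz : ℤ_[p]ˣ) : ℤ_[p]) : ℚ_[p]) ^ i *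
          (fun (n : ℕ) (a : ZMod (p ^ n)) ↦ ∑ b : ZMod m, χp b * msdMeasureTame f m α n a b)
            (n + cyclotomicExponent p)
            ((PadicInt.toZModPow (n + cyclotomicExponent p) ((teich : ℤ_[p]ˣ) : ℤ_[p]) *
                (cyclotomicGenerator p : ZMod (p ^ (n + cyclotomicExponent p))) ^
                  (PadicInt.toZModPow n (frobeniusExponent p (m : ℤ_[p]))).val) *
              (PadicInt.toZModPow (n + cyclotomicExponent p) ((zz : ℤ_[p]ˣ) : ℤ_[p]) *
                (cyclotomicGenerator p : ZMod (p ^ (n + cyclotomicExponent p))) ^ s.val)) *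
          ((s.val.choose k : ℕ) : ℚ_[p]) := fun k n ↦ by rw [hRSz_def]
  have hlim := tendsto_weightedRiemannSum_translate hdist hC hRSdef hRSz k
  have hRS : ∀ n, padicLMinusBranchRiemannSum g (((χ (p : ZMod m) : ℚ) : ℚ_[p]) * α) i k n = (c : ℚ_[p]) * RSz k n :=
    fun n ↦ by
    rw [hRSz_def]
    exact padicLMinusBranchRiemannSum_twist_eq_plus f g hmp χ hχp hB α hc i k n
  have hti := coe_rootsOfUnity_pow_ne_zero teich i
  have hT : Tendsto (padicLMinusBranchRiemannSum g (((χ (p : ZMod m) : ℚ) : ℚ_[p]) * α) i k) atTop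
      (𝓝 (((((teich : ℤ_[p]ˣ) : ℤ_[p]) : ℚ_[p]) ^ i)⁻¹ * ((c : ℚ_[p]) * ∑ j ∈ Finset.range (k + 1),
        algebraMap ℤ_[p] ℚ_[p] (Ring.choose (-frobeniusExponent p (m : ℤ_[p])) (k - j)) *
          limUnder atTop (fun n ↦ padicLRiemannSumTameBranch f m α χp i j n)))) := by
    refine (((hlim.const_mul (c : ℚ_[p])).const_mul ((((teich : ℤ_[p]ˣ) : ℤ_[p]) : ℚ_[p]) ^ i)⁻¹).congr fun n ↦ ?_)
    rw [hRS n, ← mul_assoc, ← mul_assoc, mul_right_comm _ (c : ℚ_[p]), inv_mul_cancel₀ hti, one_mul]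
  rw [padicLMinusBranchCoeff, hT.limUnder_eq, ← mul_assoc, mul_inv_cancel₀ hti, one_mul]
  rfl

omit [NeZero N'] in
/-- **Birch's lemma for the branch transforms, odd `χ`.** Under `hB : ∀ x, [x]⁻_g = c · Σ_{b mod m} χ(b) [x + b/m]⁺_f`,
`hc : ω(m)·γ^{f_m} ≡ m` and the standing hypotheses on `f`:
`C(ω(m)^i) · L⁻_p(g, χ(p)α, ω^i, T) = C(c) · (1+T)^{−f_m} · L_p(f, m, α, ω^i χ, T)` in `ℚ_p⟦T⟧` (PLUS tame branch of `f`).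
[cite: MazurTateTeitelbaum1986Invent, §I.8–I.13 (pp. 10–19)] [cite: Matsuno2000, §2 (p. 84)] -/
theorem padicLFunctionMinusBranch_twist_eq_of_birch_odd (hf : IsNewform0 f) (hQ : coeffField f = ⊥) (hpN : ¬ p ∣ N)
    (hmp : m.Coprime p) {ap : ℤ} (hap : cuspCoeff f p = ap) {α : ℚ_[p]} (hα : α ^ 2 - ap * α + p = 0) (hαu : ‖α‖ = 1)
    (χ : MulChar (ZMod m) ℚ) (hχp : χ (p : ZMod m) ^ 2 = 1) {c : ℚ}
    (hB : ∀ x : ℚ, ratMinusSymbol g x = c * ∑ b : ZMod m, χ b * ratPlusSymbol f (x + (b.val : ℚ) / m))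
    {teich : rootsOfUnity (torsionOrder p) ℤ_[p]}
    (hc : ∀ n : ℕ, PadicInt.toZModPow (n + cyclotomicExponent p) ((teich : ℤ_[p]ˣ) : ℤ_[p]) *
        (cyclotomicGenerator p : ZMod (p ^ (n + cyclotomicExponent p))) ^
          (PadicInt.toZModPow n (frobeniusExponent p (m : ℤ_[p]))).val =
          (m : ZMod (p ^ (n + cyclotomicExponent p)))) (i : ℕ) :
    C ((((teich : ℤ_[p]ˣ) : ℤ_[p]) : ℚ_[p]) ^ i) * padicLFunctionMinusBranch g (((χ (p : ZMod m) : ℚ) : ℚ_[p]) * α) i =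
      C (c : ℚ_[p]) * PowerSeries.binomialSeries ℚ_[p] (-frobeniusExponent p (m : ℤ_[p])) *
        padicLFunctionTameBranch f m α (χ.ringHomComp (Rat.castHom ℚ_[p])) i := by
  ext k
  rw [PowerSeries.coeff_C_mul, coeff_padicLFunctionMinusBranch,
    padicLMinusBranchCoeff_twist_eq_plus f g hf hQ hpN hmp hap hα hαu χ hχp hB hc i k, coeff_C_mul_binomialSeries_mul]
  congr 1
  refine Finset.sum_congr rfl fun j _ ↦ ?_
  rw [coeff_padicLFunctionTameBranch]

end BranchBirchTransform

end Literature.NumberTheory.EllipticCurves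

end
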